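import Summits.QuantumFields.YangMills.Theorems.AllWindowsColdBoxBoxHighLineTiltUEvenL2Prelims
import Summits.QuantumFields.YangMills.Theorems.AllWindowsColdBoxBoxHighLineGhostTaylor

/-!
# T-S5.13K-U — the `L²(1_D·Gaussian)` SIZE OF THE EVEN PART OF THE TILT EXPONENT, centred: `E₀[1_D·(U + V₃ − b)²] ≲ H⁸/β² + H¹²s⁶ + H⁸s⁸`
# (ASSEMBLY-S5 §6 (g4)/(g5)/(g7); LINE-19 S5 ⟨stmt-QuantumFields-24004⟩)

The tilt exponent of ✓`…Step2Tilt` is `tiltU β H = −cubicVertex − quarticWilson − β(Φ(U ·) − divLinSq) + ghostLogRatio + haarLogRatio`; its even part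
`U + V₃ = −W₄ − U_Φ + ghostLogRatio + haarLogRatio` is, on the small-field box `D = smallField H s` (`0 ≤ s ≤ 1`, `s·H² ≤ c₀`), a centred `L²(E₀)`-small quantity:
with `b := E₀[quadVal M_H] + E₀[quadVal (−(1/3)·1)]` (`M_H` the ghost quadratic form of T-S5.7d),

  `E₀[1_D · (tiltU β H + cubicVertex β H − b)²] ≤ C·(1 + log H)^m·(H⁸/β² + H¹²·s⁶ + H⁸·s⁸)`   (`H ≥ 1`, `β ≥ H⁴`).

Pointwise on `D` (✓`GaussNormalForm.sq_six_decomp_le`): `(U+V₃−b)² ≤ 6·(Maj_W + Maj_Φ + (quadVal M_H − E₀)² + (C_g H⁶(1+log H)^m s³)² + (quadVal(−I/3) − E₀)² + (C_h·n·s⁴)²)`,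
where `Maj_W`, `Maj_Φ` are the polynomial majorants of ✓12c (`QuarticL2Proof.quarticWilson_sq_le` with ✓7a `wilsonPlaquetteTaylor`, `QuarticL2Proof.phi_sq_le` with ✓7b) — ONE
integrable majorant and `gaussAvg_mono_of_nonneg` (no measurability of `tiltU` needed).  Expectations: ✓12c's `gaussAvg_wilson_majorant_le` / `gaussAvg_phi_majorant_le` (`H⁸/β²`),
✓12b in centred form (`GaussNormalForm.gaussAvg_quadVal_centred_sq_le`) twice (`ΣM_H² ≤ C_g H⁴(1+log H)^m` from 7d; `Σ(I/3)² = n/3`, `n = 3|LandauFree H| ≤ 648H⁴`),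
✓7c (`GaussNormalForm.abs_haarLogRatio_sub_quadVal_le`), and T-S5.7d `GhostTaylor` — first as a hypothesis VERBATIM (`…_of`), then discharged by w3's
✓`ghostTaylor` (p744274): ★★`gaussAvg_sfInd_mul_sq_tiltU_add_cubicVertex_sub_le` is UNCONDITIONAL.

Mathlib + tree (✓`…TiltUEvenL2Prelims`); no definitions.  HONEST LABEL: a support brick of the (e4)/(e5) sizes of the T-S5.13 assembly of the XL stub S5 of a critic-PASSed DRAFT
line, conditional on T-S5.7d; S5, U5, ⟨24004⟩ ⟨24335⟩ ⟨24336⟩ remain OPEN; route AllWindowsColdBox is DRAFT; no rung is proved; **the Yang–Mills mass gap is NOT proved by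
this file; no summit is proved by a line.**  Seat ym-line-fcl-p3 g26 (cell ym-idea-1).
-/

set_option autoImplicit false

noncomputable section

open MeasureTheory Matrix Finset
open Literature.Probability.LatticeModels (Site)
open Literature.MathematicalPhysics.QuantumLattice (plaquettesTouching)
open Literature.MathematicalPhysics.QuantumFieldTheory.AxialGauge (boxEdges)

namespace Summit.QuantumFields.YangMills.Theorems.AllWindowsColdBoxBoxHighLine

namespace GaussNormalForm

open EdgeChartGaussian (integrable_gaussWeight gaussAvg_mono_of_nonneg gaussAvg_const_fun)

/-- ★★ **T-S5.13K-U.**  Given T-S5.7d (`GhostTaylor`): there are `C, c₀ > 0, m` such that for all `H ≥ 1`, `β ≥ H⁴`, `0 ≤ s ≤ 1` with `s·H² ≤ c₀` there is a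
constant `b` (`= E₀[quadVal M_H] + E₀[quadVal(−I/3)]`) with
`E₀[1_{smallField H s} · (tiltU β H + cubicVertex β H − b)²] ≤ C·(1 + log H)^m·(H⁸/β² + H¹²·s⁶ + H⁸·s⁸)`. -/
theorem gaussAvg_sfInd_mul_sq_tiltU_add_cubicVertex_sub_le_of (h7d : GhostTaylor) :
    ∃ C c₀ : ℝ, ∃ m : ℕ, 0 < c₀ ∧ ∀ H : ℕ, 1 ≤ H → ∀ β : ℝ, (H : ℝ) ^ 4 ≤ β → ∀ s : ℝ, 0 ≤ s → s ≤ 1 → s * (H : ℝ) ^ 2 ≤ c₀ →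
      ∃ b : ℝ, gaussAvg β H (fun a => sfInd H s a * (tiltU β H a + cubicVertex β H a - b) ^ 2) ≤
        C * (1 + Real.log H) ^ m * ((H : ℝ) ^ 8 / β ^ 2 + (H : ℝ) ^ 12 * s ^ 6 + (H : ℝ) ^ 8 * s ^ 8) := by
  obtain ⟨Cg, c₀, m, hc₀, hg⟩ := h7d
  obtain ⟨C₇, hC₇⟩ := wilsonPlaquetteTaylor
  obtain ⟨CΦ, hCΦ⟩ := phiTaylor
  obtain ⟨Cb, hCb0, hCb⟩ := gaussAvg_quadVal_centred_sq_le
  obtain ⟨Ch, hCh0, hCh⟩ := abs_haarLogRatio_sub_quadVal_le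
  -- `Cg ≥ 0` (read off at `H = 1`)
  have hCg0 : 0 ≤ Cg := by
    obtain ⟨M, hM, -⟩ := hg 1 le_rfl
    have hS : 0 ≤ ∑ i, ∑ j, M i j ^ 2 := Finset.sum_nonneg fun i _ => Finset.sum_nonneg fun j _ => sq_nonneg _
    have e : Cg * ((1 : ℕ) : ℝ) ^ 4 * (1 + Real.log ((1 : ℕ) : ℝ)) ^ m = Cg := by
      rw [Nat.cast_one, Real.log_one, add_zero, one_pow, one_pow, mul_one, mul_one]
    rw [e] at hM
    linarith
  -- the constants of ✓12c's two majorants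
  set C₈ : ℝ := 81 * (60 * 1036 ^ 2) ^ 2 with hC₈
  set cW : ℝ := (C₇ ^ 2 + 144) * C₈ * 9720 ^ 2 with hcW
  set cΦ : ℝ := CΦ ^ 2 * 16 * 512 * 16 * 8 * C₈ with hcΦ
  refine ⟨6 * (cW + cΦ + Cb * Cg + Cg ^ 2 + 216 * Cb + Ch ^ 2 * 216 ^ 2), c₀, 2 * m, hc₀, fun H hH β hβ s hs0 hs1 hsH => ?_⟩
  have hH' : (1 : ℝ) ≤ H := by exact_mod_cast hH
  have hβpos : 0 < β := lt_of_lt_of_le (by positivity) hβ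
  have hlog : 0 ≤ Real.log H := Real.log_nonneg hH'
  obtain ⟨M, hM, hT⟩ := hg H hH
  -- the Haar quadratic form, the two Gaussian means, the two sup constants
  set Mh : Matrix (LandauFree H × Fin 3) (LandauFree H × Fin 3) ℝ := (-(1 / 3 : ℝ)) • (1 : Matrix (LandauFree H × Fin 3) (LandauFree H × Fin 3) ℝ)
    with hMh
  -- opaque abbreviations (no `set`: unfolding `Fintype.card (LandauFree H)` under `whnf` is prohibitively expensive)
  obtain ⟨cM, hcM⟩ : ∃ c : ℝ, c = gaussAvg β H (quadVal M) := ⟨_, rfl⟩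
  obtain ⟨ch, hch⟩ : ∃ c : ℝ, c = gaussAvg β H (quadVal Mh) := ⟨_, rfl⟩
  obtain ⟨n, hn⟩ : ∃ n : ℝ, n = (Fintype.card (LandauFree H) : ℝ) := ⟨_, rfl⟩
  have hnle : n ≤ 216 * (H : ℝ) ^ 4 := by rw [hn]; exact SmallFieldFP.card_landauFree_le hH
  have hn0 : 0 ≤ n := by rw [hn]; exact Nat.cast_nonneg _
  obtain ⟨K₁, hK₁⟩ : ∃ K : ℝ, K = Cg * (H : ℝ) ^ 6 * (1 + Real.log H) ^ m * s ^ 3 := ⟨_, rfl⟩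
  obtain ⟨K₂, hK₂⟩ : ∃ K : ℝ, K = Ch * n * s ^ 4 := ⟨_, rfl⟩
  have hK₁0 : 0 ≤ K₁ := by rw [hK₁]; positivity
  have hK₂0 : 0 ≤ K₂ := by rw [hK₂]; positivity
  refine ⟨cM + ch, ?_⟩
  -- the Wilson dominator from 7a, as in ✓12c
  have hKW : ∀ (H : ℕ) (x : Site 4) (μ ν : Fin 4), μ ≠ ν → ∀ a : LandauFree H → E3,
      (chartPlaqCost H x μ ν a - linCurvSq H (x, μ, ν) a - chartPlaqCostOdd H x μ ν a) ^ 2 ≤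
        (C₇ ^ 2 + 144) * (∑ i : Fin 4, ‖plaqVar H x μ ν a i‖ ^ 2) ^ 4 := by
    intro H x μ ν hμν a
    obtain ⟨T, -, hT'⟩ := hC₇ μ ν hμν
    rw [PlaqObsL2.linCurvSq_eq_norm_plaqLin_sq]
    exact PlaqObsL2.evenRem_sq_le H x μ ν (fun t a ht0 ht1 hv => (hT' H x t a ht0 ht1 hv).1) a
  have hPTle : ((plaquettesTouching (boxEdges 4 (2 * H + 1))).card : ℝ) ≤ 9720 * (H : ℝ) ^ 4 := QuarticL2Proof.card_touching_le hH
  have hPT0 : (0 : ℝ) ≤ (plaquettesTouching (boxEdges 4 (2 * H + 1))).card := Nat.cast_nonneg _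
  have hcW0 : 0 ≤ β ^ 2 * (plaquettesTouching (boxEdges 4 (2 * H + 1))).card * (C₇ ^ 2 + 144) :=
    mul_nonneg (mul_nonneg (sq_nonneg _) hPT0) (by positivity)
  have hX := PhiTaylorProof.card_interiorSites_le H
  have hXc0 : (0 : ℝ) ≤ (interiorSites H).card := Nat.cast_nonneg _
  have hcΦ0 : 0 ≤ β ^ 2 * CΦ ^ 2 * ((interiorSites H).card * 512) :=
    mul_nonneg (mul_nonneg (sq_nonneg _) (sq_nonneg _)) (mul_nonneg hXc0 (by norm_num))
  -- the two polynomial majorants of ✓12c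
  set MajW : (LandauFree H → E3) → ℝ := fun a =>
    (β ^ 2 * (plaquettesTouching (boxEdges 4 (2 * H + 1))).card * (C₇ ^ 2 + 144)) *
      ∑ p ∈ plaquettesTouching (boxEdges 4 (2 * H + 1)), (∑ i : Fin 4, ‖plaqVar H p.1 p.2.1.1 p.2.1.2 a i‖ ^ 2) ^ 4 with hMajW
  set MajΦ : (LandauFree H → E3) → ℝ := fun a =>
    (β ^ 2 * CΦ ^ 2 * ((interiorSites H).card * 512)) * ∑ x ∈ interiorSites H, ∑ e : LandauFree H,
      |gradVec H x e| * (∑ j : Fin 4, ‖plaqVar H e.1.1.1 e.1.1.2 e.1.1.2 a j‖ ^ 2) ^ 4 with hMajΦ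
  have hW0 : ∀ a, 0 ≤ MajW a := fun a =>
    mul_nonneg hcW0 (Finset.sum_nonneg fun p _ => pow_nonneg (Finset.sum_nonneg fun i _ => sq_nonneg _) 4)
  have hΦ0 : ∀ a, 0 ≤ MajΦ a := fun a =>
    mul_nonneg hcΦ0 (Finset.sum_nonneg fun x _ => Finset.sum_nonneg fun e _ =>
      mul_nonneg (abs_nonneg _) (pow_nonneg (Finset.sum_nonneg fun i _ => sq_nonneg _) 4))
  -- (1) pointwise domination
  have hdom : ∀ a, sfInd H s a * (tiltU β H a + cubicVertex β H a - (cM + ch)) ^ 2 ≤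
      6 * (MajW a + MajΦ a + (quadVal M a - cM) ^ 2 + K₁ ^ 2 + (quadVal Mh a - ch) ^ 2 + K₂ ^ 2) := by
    intro a
    by_cases ha : a ∈ smallField H s
    · rw [sfInd, Set.indicator_of_mem ha, one_mul, tiltU_add_cubicVertex]
      exact sq_six_decomp_le (QuarticL2Proof.quarticWilson_sq_le hKW β H a) (QuarticL2Proof.phi_sq_le (fun a => (hCΦ H hH a).2.1) β a)
        (by rw [hK₁]; exact hT s a hs0 hsH ha) (by rw [hK₂, hn]; exact hCh H s hs0 hs1 a ha)
    · rw [sfInd, Set.indicator_of_notMem ha, zero_mul]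
      have h1 := hW0 a
      have h2 := hΦ0 a
      have h3 := sq_nonneg (quadVal M a - cM)
      have h4 := sq_nonneg K₁
      have h5 := sq_nonneg (quadVal Mh a - ch)
      have h6 := sq_nonneg K₂
      linarith
  -- (2) integrability of the majorant
  have hiW : Integrable (fun a => MajW a * gaussWeight β H a) := QuarticL2Proof.integrable_wilson_majorant H hβpos _
  have hiΦ : Integrable (fun a => MajΦ a * gaussWeight β H a) := QuarticL2Proof.integrable_phi_majorant hβpos _
  have hiM : Integrable (fun a => (quadVal M a - cM) ^ 2 * gaussWeight β H a) := integrable_quadVal_sub_pow_mul_gaussWeight hβpos M cM 2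
  have hih : Integrable (fun a => (quadVal Mh a - ch) ^ 2 * gaussWeight β H a) := integrable_quadVal_sub_pow_mul_gaussWeight hβpos Mh ch 2
  have hiK₁ : Integrable (fun a : LandauFree H → E3 => K₁ ^ 2 * gaussWeight β H a) := (integrable_gaussWeight H hβpos).const_mul _
  have hiK₂ : Integrable (fun a : LandauFree H → E3 => K₂ ^ 2 * gaussWeight β H a) := (integrable_gaussWeight H hβpos).const_mul _
  have hi1 : Integrable (fun a => (MajW a + MajΦ a) * gaussWeight β H a) :=
    (hiW.add hiΦ).congr (Filter.Eventually.of_forall fun a => by simp only [Pi.add_apply]; ring)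
  have hi2 : Integrable (fun a => (MajW a + MajΦ a + (quadVal M a - cM) ^ 2) * gaussWeight β H a) :=
    (hi1.add hiM).congr (Filter.Eventually.of_forall fun a => by simp only [Pi.add_apply]; ring)
  have hi3 : Integrable (fun a => (MajW a + MajΦ a + (quadVal M a - cM) ^ 2 + K₁ ^ 2) * gaussWeight β H a) :=
    (hi2.add hiK₁).congr (Filter.Eventually.of_forall fun a => by simp only [Pi.add_apply]; ring)
  have hi4 : Integrable (fun a => (MajW a + MajΦ a + (quadVal M a - cM) ^ 2 + K₁ ^ 2 + (quadVal Mh a - ch) ^ 2) * gaussWeight β H a) :=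
    (hi3.add hih).congr (Filter.Eventually.of_forall fun a => by simp only [Pi.add_apply]; ring)
  have hi5 : Integrable (fun a => (MajW a + MajΦ a + (quadVal M a - cM) ^ 2 + K₁ ^ 2 + (quadVal Mh a - ch) ^ 2 + K₂ ^ 2) * gaussWeight β H a) :=
    (hi4.add hiK₂).congr (Filter.Eventually.of_forall fun a => by simp only [Pi.add_apply]; ring)
  have hiMaj : Integrable (fun a => (6 * (MajW a + MajΦ a + (quadVal M a - cM) ^ 2 + K₁ ^ 2 + (quadVal Mh a - ch) ^ 2 + K₂ ^ 2)) * gaussWeight β H a) :=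
    (hi5.const_mul 6).congr (Filter.Eventually.of_forall fun a => by ring)
  -- (3) expectations of the summands
  have hEW : gaussAvg β H MajW ≤ cW * ((H : ℝ) ^ 8 / β ^ 2) := by
    calc gaussAvg β H MajW ≤ (β ^ 2 * (plaquettesTouching (boxEdges 4 (2 * H + 1))).card * (C₇ ^ 2 + 144)) *
          ((plaquettesTouching (boxEdges 4 (2 * H + 1))).card * (C₈ / β ^ 4)) := QuarticL2Proof.gaussAvg_wilson_majorant_le H hβpos hcW0
      _ = (C₇ ^ 2 + 144) * C₈ * ((plaquettesTouching (boxEdges 4 (2 * H + 1))).card : ℝ) ^ 2 / β ^ 2 := by field_simp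
      _ ≤ (C₇ ^ 2 + 144) * C₈ * (9720 * (H : ℝ) ^ 4) ^ 2 / β ^ 2 := by
          have h2 : ((plaquettesTouching (boxEdges 4 (2 * H + 1))).card : ℝ) ^ 2 ≤ (9720 * (H : ℝ) ^ 4) ^ 2 := pow_le_pow_left₀ hPT0 hPTle 2
          have hc' : 0 ≤ (C₇ ^ 2 + 144) * C₈ := by positivity
          exact div_le_div_of_nonneg_right (mul_le_mul_of_nonneg_left h2 hc') (by positivity)
      _ = cW * ((H : ℝ) ^ 8 / β ^ 2) := by simp only [hcW]; ring
  have hEΦ : gaussAvg β H MajΦ ≤ cΦ * ((H : ℝ) ^ 8 / β ^ 2) := by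
    calc gaussAvg β H MajΦ ≤ (β ^ 2 * CΦ ^ 2 * ((interiorSites H).card * 512)) * ((interiorSites H).card * (8 * (C₈ / β ^ 4))) :=
          QuarticL2Proof.gaussAvg_phi_majorant_le hβpos hcΦ0
      _ = CΦ ^ 2 * 512 * 8 * C₈ * ((interiorSites H).card : ℝ) ^ 2 / β ^ 2 := by field_simp
      _ ≤ CΦ ^ 2 * 512 * 8 * C₈ * (16 * (H : ℝ) ^ 4) ^ 2 / β ^ 2 := by
          have h2 : ((interiorSites H).card : ℝ) ^ 2 ≤ (16 * (H : ℝ) ^ 4) ^ 2 := pow_le_pow_left₀ hXc0 hX 2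
          have hc : 0 ≤ CΦ ^ 2 * 512 * 8 * C₈ := by positivity
          exact div_le_div_of_nonneg_right (mul_le_mul_of_nonneg_left h2 hc) (by positivity)
      _ = cΦ * ((H : ℝ) ^ 8 / β ^ 2) := by simp only [hcΦ]; ring
  have hEM : gaussAvg β H (fun a => (quadVal M a - cM) ^ 2) ≤ Cb * Cg * ((H : ℝ) ^ 8 * (1 + Real.log H) ^ m / β ^ 2) := by
    calc gaussAvg β H (fun a => (quadVal M a - cM) ^ 2) ≤ Cb * ((H : ℝ) ^ 4 / β ^ 2) * ∑ i, ∑ j, M i j ^ 2 := by rw [hcM]; exact hCb H hH β hβpos M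
      _ ≤ Cb * ((H : ℝ) ^ 4 / β ^ 2) * (Cg * (H : ℝ) ^ 4 * (1 + Real.log H) ^ m) := mul_le_mul_of_nonneg_left hM (by positivity)
      _ = Cb * Cg * ((H : ℝ) ^ 8 * (1 + Real.log H) ^ m / β ^ 2) := by ring
  have hEh : gaussAvg β H (fun a => (quadVal Mh a - ch) ^ 2) ≤ 216 * Cb * ((H : ℝ) ^ 8 / β ^ 2) := by
    have hc3 : (Fintype.card (LandauFree H × Fin 3) : ℝ) * (-(1 / 3 : ℝ)) ^ 2 = n / 3 := by
      rw [Fintype.card_prod, Fintype.card_fin, Nat.cast_mul, ← hn]; push_cast; ring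
    have h := hCb H hH β hβpos Mh
    rw [sum_sq_smul_one, hc3, ← hch] at h
    have hq : 0 ≤ Cb * ((H : ℝ) ^ 4 / β ^ 2) := mul_nonneg hCb0 (div_nonneg (pow_nonneg (Nat.cast_nonneg _) 4) (sq_nonneg _))
    have hn3 : n / 3 ≤ 216 * (H : ℝ) ^ 4 := (div_le_self hn0 (by norm_num)).trans hnle
    calc gaussAvg β H (fun a => (quadVal Mh a - ch) ^ 2) ≤ Cb * ((H : ℝ) ^ 4 / β ^ 2) * (n / 3) := h
      _ ≤ Cb * ((H : ℝ) ^ 4 / β ^ 2) * (216 * (H : ℝ) ^ 4) := mul_le_mul_of_nonneg_left hn3 hq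
      _ = 216 * Cb * ((H : ℝ) ^ 8 / β ^ 2) := by ring
  -- (4) the expectation of the majorant, by linearity
  have hEMaj : gaussAvg β H (fun a => 6 * (MajW a + MajΦ a + (quadVal M a - cM) ^ 2 + K₁ ^ 2 + (quadVal Mh a - ch) ^ 2 + K₂ ^ 2)) =
      6 * (gaussAvg β H MajW + gaussAvg β H MajΦ + gaussAvg β H (fun a => (quadVal M a - cM) ^ 2) + K₁ ^ 2 +
        gaussAvg β H (fun a => (quadVal Mh a - ch) ^ 2) + K₂ ^ 2) := by
    rw [EdgeChartGaussian.gaussAvg_const_mul]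
    congr 1
    rw [show (fun a => MajW a + MajΦ a + (quadVal M a - cM) ^ 2 + K₁ ^ 2 + (quadVal Mh a - ch) ^ 2 + K₂ ^ 2) =
      fun a => (MajW a + MajΦ a + (quadVal M a - cM) ^ 2 + K₁ ^ 2 + (quadVal Mh a - ch) ^ 2) + K₂ ^ 2 from rfl,
      EdgeChartGaussian.gaussAvg_add β H hi4 hiK₂, gaussAvg_const_fun H hβpos]
    rw [show (fun a => MajW a + MajΦ a + (quadVal M a - cM) ^ 2 + K₁ ^ 2 + (quadVal Mh a - ch) ^ 2) =
      fun a => (MajW a + MajΦ a + (quadVal M a - cM) ^ 2 + K₁ ^ 2) + (quadVal Mh a - ch) ^ 2 from rfl,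
      EdgeChartGaussian.gaussAvg_add β H hi3 hih]
    rw [show (fun a => MajW a + MajΦ a + (quadVal M a - cM) ^ 2 + K₁ ^ 2) =
      fun a => (MajW a + MajΦ a + (quadVal M a - cM) ^ 2) + K₁ ^ 2 from rfl,
      EdgeChartGaussian.gaussAvg_add β H hi2 hiK₁, gaussAvg_const_fun H hβpos]
    rw [show (fun a => MajW a + MajΦ a + (quadVal M a - cM) ^ 2) = fun a => (MajW a + MajΦ a) + (quadVal M a - cM) ^ 2 from rfl,
      EdgeChartGaussian.gaussAvg_add β H hi1 hiM]
    rw [show (fun a => MajW a + MajΦ a) = fun a => MajW a + MajΦ a from rfl, EdgeChartGaussian.gaussAvg_add β H hiW hiΦ]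
  -- (5) assemble
  set L : ℝ := (1 + Real.log H) ^ (2 * m) with hL
  set X : ℝ := (H : ℝ) ^ 8 / β ^ 2 + (H : ℝ) ^ 12 * s ^ 6 + (H : ℝ) ^ 8 * s ^ 8 with hXdef
  have hL1 : 1 ≤ L := one_le_pow₀ (by linarith)
  have hLm : (1 + Real.log H) ^ m ≤ L := by
    rw [hL, pow_mul']
    exact le_self_pow₀ (one_le_pow₀ (by linarith)) two_ne_zero
  have hX0 : 0 ≤ X := by positivity
  have hX1 : (H : ℝ) ^ 8 / β ^ 2 ≤ X := by
    have : 0 ≤ (H : ℝ) ^ 12 * s ^ 6 + (H : ℝ) ^ 8 * s ^ 8 := by positivity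
    linarith
  have hX2 : (H : ℝ) ^ 12 * s ^ 6 ≤ X := by
    have : 0 ≤ (H : ℝ) ^ 8 / β ^ 2 + (H : ℝ) ^ 8 * s ^ 8 := by positivity
    linarith
  have hX3 : (H : ℝ) ^ 8 * s ^ 8 ≤ X := by
    have : 0 ≤ (H : ℝ) ^ 8 / β ^ 2 + (H : ℝ) ^ 12 * s ^ 6 := by positivity
    linarith
  have hLX : X ≤ L * X := le_mul_of_one_le_left hX0 hL1
  have t1 : gaussAvg β H MajW ≤ cW * (L * X) := hEW.trans (mul_le_mul_of_nonneg_left (hX1.trans hLX) (by positivity))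
  have t2 : gaussAvg β H MajΦ ≤ cΦ * (L * X) := hEΦ.trans (mul_le_mul_of_nonneg_left (hX1.trans hLX) (by positivity))
  have t3 : gaussAvg β H (fun a => (quadVal M a - cM) ^ 2) ≤ Cb * Cg * (L * X) := by
    refine hEM.trans (mul_le_mul_of_nonneg_left ?_ (by positivity))
    calc (H : ℝ) ^ 8 * (1 + Real.log H) ^ m / β ^ 2 = (1 + Real.log H) ^ m * ((H : ℝ) ^ 8 / β ^ 2) := by ring
      _ ≤ L * X := mul_le_mul hLm hX1 (by positivity) (by positivity)
  have t4 : K₁ ^ 2 ≤ Cg ^ 2 * (L * X) := by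
    have e : K₁ ^ 2 = Cg ^ 2 * ((1 + Real.log H) ^ (2 * m) * ((H : ℝ) ^ 12 * s ^ 6)) := by rw [hK₁]; ring
    rw [e]
    exact mul_le_mul_of_nonneg_left (mul_le_mul_of_nonneg_left hX2 (by positivity)) (sq_nonneg _)
  have t5 : gaussAvg β H (fun a => (quadVal Mh a - ch) ^ 2) ≤ 216 * Cb * (L * X) :=
    hEh.trans (mul_le_mul_of_nonneg_left (hX1.trans hLX) (by positivity))
  have t6 : K₂ ^ 2 ≤ Ch ^ 2 * 216 ^ 2 * (L * X) := by
    have e : K₂ ^ 2 = Ch ^ 2 * (n ^ 2 * s ^ 8) := by rw [hK₂]; ring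
    rw [e, mul_assoc]
    refine mul_le_mul_of_nonneg_left ?_ (sq_nonneg _)
    have hn2 : n ^ 2 ≤ (216 * (H : ℝ) ^ 4) ^ 2 := pow_le_pow_left₀ hn0 hnle 2
    calc n ^ 2 * s ^ 8 ≤ (216 * (H : ℝ) ^ 4) ^ 2 * s ^ 8 := mul_le_mul_of_nonneg_right hn2 (by positivity)
      _ = 216 ^ 2 * ((H : ℝ) ^ 8 * s ^ 8) := by ring
      _ ≤ 216 ^ 2 * (L * X) := mul_le_mul_of_nonneg_left (hX3.trans hLX) (by positivity)
  have hsf0 : ∀ a, 0 ≤ sfInd H s a * (tiltU β H a + cubicVertex β H a - (cM + ch)) ^ 2 := fun a =>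
    mul_nonneg (by unfold sfInd; exact Set.indicator_nonneg (fun _ _ => zero_le_one) _) (sq_nonneg _)
  calc gaussAvg β H (fun a => sfInd H s a * (tiltU β H a + cubicVertex β H a - (cM + ch)) ^ 2)
      ≤ gaussAvg β H (fun a => 6 * (MajW a + MajΦ a + (quadVal M a - cM) ^ 2 + K₁ ^ 2 + (quadVal Mh a - ch) ^ 2 + K₂ ^ 2)) :=
        gaussAvg_mono_of_nonneg H hβpos hsf0 hdom hiMaj
    _ = 6 * (gaussAvg β H MajW + gaussAvg β H MajΦ + gaussAvg β H (fun a => (quadVal M a - cM) ^ 2) + K₁ ^ 2 +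
          gaussAvg β H (fun a => (quadVal Mh a - ch) ^ 2) + K₂ ^ 2) := hEMaj
    _ ≤ 6 * (cW * (L * X) + cΦ * (L * X) + Cb * Cg * (L * X) + Cg ^ 2 * (L * X) + 216 * Cb * (L * X) + Ch ^ 2 * 216 ^ 2 * (L * X)) := by
        linarith
    _ = 6 * (cW + cΦ + Cb * Cg + Cg ^ 2 + 216 * Cb + Ch ^ 2 * 216 ^ 2) * (1 + Real.log H) ^ (2 * m) *
          ((H : ℝ) ^ 8 / β ^ 2 + (H : ℝ) ^ 12 * s ^ 6 + (H : ℝ) ^ 8 * s ^ 8) := by simp only [hL, hXdef]; ring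

/-- ★★ **T-S5.13K-U, unconditional** (✓`ghostTaylor`, w3 g40): `E₀[1_D·(tiltU + cubicVertex − b)²] ≤ C(1+log H)^m(H⁸/β² + H¹²s⁶ + H⁸s⁸)`. -/
theorem gaussAvg_sfInd_mul_sq_tiltU_add_cubicVertex_sub_le :
    ∃ C c₀ : ℝ, ∃ m : ℕ, 0 < c₀ ∧ ∀ H : ℕ, 1 ≤ H → ∀ β : ℝ, (H : ℝ) ^ 4 ≤ β → ∀ s : ℝ, 0 ≤ s → s ≤ 1 → s * (H : ℝ) ^ 2 ≤ c₀ →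
      ∃ b : ℝ, gaussAvg β H (fun a => sfInd H s a * (tiltU β H a + cubicVertex β H a - b) ^ 2) ≤
        C * (1 + Real.log H) ^ m * ((H : ℝ) ^ 8 / β ^ 2 + (H : ℝ) ^ 12 * s ^ 6 + (H : ℝ) ^ 8 * s ^ 8) :=
  gaussAvg_sfInd_mul_sq_tiltU_add_cubicVertex_sub_le_of ghostTaylor

end GaussNormalForm

end Summit.QuantumFields.YangMills.Theorems.AllWindowsColdBoxBoxHighLine

end
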